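import Summits.Ventures.PercRepro.S2DichotomyTools
import Summits.Ventures.PercRepro.S2TailCell
import Summits.Ventures.PercRepro.S2SpanningCount
import Summits.Ventures.PercRepro.S2CountsCell
import Summits.Ventures.PercRepro.S2SpreadTail
import Summits.Ventures.PercRepro.S2FlatSharp
import Summits.Ventures.PercRepro.S2BasesTriangles
import Summits.Ventures.PercRepro.S2PhiFourteenFive
import Summits.Ventures.PercRepro.S2CapFree
import Summits.Ventures.PercRepro.TriangleCapEightI
import Summits.Ventures.PercRepro.RankLevelSetFourCircuitNullityFour
import Summits.Ventures.PercRepro.S1FiveCircuitBase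

/-!
# PercRepro — S2: THE TWICE-SCALED CELL `(12, 6)` OF THE `q = 5` WINDOW — standard caps, at `K₂ = 14474` (p7, gen 14; sub-claim S2; the `p = 14` row)

The second coloop step of the cell `(14, 6)`: on `(M ＼ {e}) ＼ {f}` (an `e`-free core of rank `12` on `18` points) the weighted inequality
`(Φ(14,5) − 6)/4 · #U(12, 5) ≤ mid(12, 5)` by the kit's nested dichotomy (`gencell15.py`). **`ThmN.c025_twelve_six_k2`**. Axioms: standard.
-/

open scoped Matroid

namespace PercRepro

namespace ThmN

open Set

variable {α : Type}

/-- The standard caps at `(12, 6)`: `s₃ ≤ 10`, `s₄ ≤ 46`, `s₅ ≤ 234` on every `e`-free core of nullity `6`. -/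
theorem caps_twelve_six_k2 (M : Matroid α) [M.Finite]
    (hd : M.E.encard = M.eRank + ((6 : ℕ) : ℕ∞))
    (hfree : ∀ e ∈ M.E, ∃ A ⊆ M.E \ {e}, e ∉ M.closure A ∧ e ∉ M.closure ((M.E \ {e}) \ A)) :
    {C : Set α | M.IsCircuit C ∧ C.ncard = 3}.ncard ≤ 10 ∧
      {C : Set α | M.IsCircuit C ∧ C.ncard = 4}.ncard ≤ 46 ∧
        {C : Set α | M.IsCircuit C ∧ C.ncard = 5}.ncard ≤ 234 := by
  have hs3 := TriangleCap.core_ncard_triangles_le_cq3 M hfree hd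
  rw [show TriangleCap.cq3 6 = 10 by decide] at hs3
  have hs4 := ncard_fourCircuits_le_avgChain16 6 M hfree hd
  rw [show avgChain16 6 = 46 by decide] at hs4
  have hs5 := S1.ncard_fiveCircuits_le_avgChain5b 6 M hfree hd
  rw [show S1.avgChain5b 6 = 234 by decide] at hs5
  exact ⟨hs3, hs4, hs5⟩

/-- The tail side of the cell `(12, 6)` on the caps `10 / 46 / 234` with the spanning count `S` a parameter (the kit's rank part `125308994 / 2115`). -/
theorem tail_twelve_six_k2 (S m : ℕ) (h : (1024 : ℚ) * ((125308994 / 2115 : ℚ) + (S : ℚ)) ≤ (m : ℚ) * 2 ^ 18) :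
    1024 * ((((12 + 6).choose 4 : ℚ) +
      (∑ j ∈ Finset.range 6, (Nat.choose (min 5 ((6 + 3) / 2 + 1 - 2)) j : ℚ) / (((j + 1) + 3 * (j + 1).choose 2 + 3 * (j + 1).choose 3 + 2 * (j + 1).choose 4 : ℕ) : ℚ)) *
        ((10 * (12 + 6 - 3).choose 2 + 46 * (12 + 6 - 4) + 234 : ℕ) : ℚ) +
      ((∑ j ∈ Finset.range 6, (Nat.choose 5 j : ℚ) / (((j + 1) + 3 * (j + 1).choose 2 + 3 * (j + 1).choose 3 + 2 * (j + 1).choose 4 : ℕ) : ℚ)) -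
        (∑ j ∈ Finset.range 6, (Nat.choose (min 5 ((6 + 3) / 2 + 1 - 2)) j : ℚ) / (((j + 1) + 3 * (j + 1).choose 2 + 3 * (j + 1).choose 3 + 2 * (j + 1).choose 4 : ℕ) : ℚ))) *
        ((10 : ℕ).choose 5 : ℚ)) +
      (((12 + 6).choose 3 * 2 ^ 3 + (12 + 6).choose 2 * 2 + (12 + 6) + 1 : ℕ) : ℚ) +
      (((12 + 6).choose 5 : ℚ) + (∑ j ∈ Finset.range (6), (Nat.choose (min 13 ((6 + 6) / 2 + 1 - 2)) j : ℚ) / (((j + 1) + 3 * (j + 1).choose 2 + 3 * (j + 1).choose 3 + 2 * (j + 1).choose 4 : ℕ) : ℚ)) * ((10 * (12 + 6 - 3).choose 3 + 46 * (12 + 6 - 4).choose 2 + 234 * (12 + 6 - 5) + (6 + 5).choose 6 : ℕ) : ℚ) +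
        ((∑ j ∈ Finset.range (6), (Nat.choose (min 19 (5 + 6) - 6) j : ℚ) / (((j + 1) + 3 * (j + 1).choose 2 + 3 * (j + 1).choose 3 + 2 * (j + 1).choose 4 : ℕ) : ℚ)) - (∑ j ∈ Finset.range (6), (Nat.choose (min 13 ((6 + 6) / 2 + 1 - 2)) j : ℚ) / (((j + 1) + 3 * (j + 1).choose 2 + 3 * (j + 1).choose 3 + 2 * (j + 1).choose 4 : ℕ) : ℚ))) *
        ((min 19 (5 + 6)).choose 6 : ℚ)) +
      (S : ℚ)) ≤ (m : ℚ) * 2 ^ (12 + 6) := by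
  have hsm : (∑ j ∈ Finset.range (6), (Nat.choose (min 13 ((6 + 6) / 2 + 1 - 2)) j : ℚ) / (((j + 1) + 3 * (j + 1).choose 2 + 3 * (j + 1).choose 3 + 2 * (j + 1).choose 4 : ℕ) : ℚ)) = 12767 / 4230 := by
    norm_num [Finset.sum_range_succ, Nat.choose]
  have hsg : (∑ j ∈ Finset.range (6), (Nat.choose (min 19 (5 + 6) - 6) j : ℚ) / (((j + 1) + 3 * (j + 1).choose 2 + 3 * (j + 1).choose 3 + 2 * (j + 1).choose 4 : ℕ) : ℚ)) = 12767 / 4230 := by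
    norm_num [Finset.sum_range_succ, Nat.choose]
  have hs4m : (∑ j ∈ Finset.range 6, (Nat.choose (min 5 ((6 + 3) / 2 + 1 - 2)) j : ℚ) / (((j + 1) + 3 * (j + 1).choose 2 + 3 * (j + 1).choose 3 + 2 * (j + 1).choose 4 : ℕ) : ℚ)) = 329 / 180 := by
    norm_num [Finset.sum_range_succ, Nat.choose]
  have hs4g : (∑ j ∈ Finset.range 6, (Nat.choose 5 j : ℚ) / (((j + 1) + 3 * (j + 1).choose 2 + 3 * (j + 1).choose 3 + 2 * (j + 1).choose 4 : ℕ) : ℚ)) = 12767 / 4230 := by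
    norm_num [Finset.sum_range_succ, Nat.choose]
  rw [hsm, hsg, hs4m, hs4g]
  norm_num [Nat.choose] at h ⊢
  linarith

/-- **The cell `(12, 6)` at `K = 14474`**: the cases `ν = 5, 4` by the concentrated tail, the spread case by the triangle trade-off
(`s₃ ≤ 10`: the sharp count `19803` against the kit's spanning bound, need `21145`; `s₃ ≥ 11`: `19803` against three triangles'
Bonferroni, need `22248`); the rank part of the tail at `f = 8`, `f′ = 7`. -/
theorem c025_twelve_six_k2 (M : Matroid α) [M.Finite]
    (hR : M.eRank = ((12 : ℕ) : ℕ∞)) (hn : M.E.ncard = 12 + 6)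
    (hfree : ∀ e ∈ M.E, ∃ A ⊆ M.E \ {e}, e ∉ M.closure A ∧ e ∉ M.closure ((M.E \ {e}) \ A)) :
    ((phiK 14 5 - 6) / 4) * (Matroid.topCount M 12 5 : ℚ) ≤ (Matroid.midCount M 12 5 : ℚ) := by
  classical
  have hd : M.E.encard = M.eRank + ((6 : ℕ) : ℕ∞) := by
    rw [hR, ← M.ground_finite.cast_ncard_eq, hn]
    push_cast
    ring
  obtain ⟨hs3, hs4, hs5⟩ := caps_twelve_six_k2 M hd hfree
  have full : ∀ (k : ℕ) {W : Set α}, W ⊆ M.E → W.encard = M.eRk W + k →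
      Matroid.topCount M 12 5 ≤ ∑ m ∈ Finset.Icc 5 6, ∑ j ∈ Finset.Icc (m + k - 6) m,
        W.ncard.choose j * (12 + 6 - W.ncard).choose (m - j) := by
    intro k W hW hWk
    refine (S2.topCount_le_sum_spanning M hR hd 5).trans ?_
    refine Finset.sum_le_sum (fun m _ => ?_)
    have h := S2.ncard_spanning_compl_le_of_nullity M hW hd hWk (m := m)
    rw [hn] at h
    exact h
  have span : ∀ (k : ℕ) {W : Set α}, W ⊆ M.E → W.encard = M.eRk W + k →
      {X : Set α | X ⊆ M.E ∧ M.eRk X = M.eRank}.ncard ≤ ∑ m ∈ Finset.range (6 + 1), ∑ j ∈ Finset.Icc (m + k - 6) m,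
        W.ncard.choose j * (12 + 6 - W.ncard).choose (m - j) := by
    intro k W hW hWk
    have h := S2.ncard_spanning_le_of_nullity M hW hd hWk
    rw [hn] at h
    exact h
  have cell : ∀ (U S m : ℕ), Matroid.topCount M 12 5 ≤ U → {X : Set α | X ⊆ M.E ∧ M.eRk X = M.eRank}.ncard ≤ S → m ≤ 1024 →
      1024 * (U : ℚ) ≤ ((1024 - m : ℕ) : ℚ) * 2 ^ (6 - 5) * (14474 : ℚ) →
      (1024 : ℚ) * ((125308994 / 2115 : ℚ) + (S : ℚ)) ≤ (m : ℚ) * 2 ^ 18 → ((phiK 14 5 - 6) / 4) * (Matroid.topCount M 12 5 : ℚ) ≤ (Matroid.midCount M 12 5 : ℚ) := by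
    intro U S m hU hS hm hpoly htail
    exact c025_core_five_cell_of_topCount_spanning_xqictq5g M 12 6 (by norm_num) hR hn hfree 10 46 234 hs3 hs4 hs5 U hU S hS
      14474 (by norm_num) (((phiK 14 5 - 6) / 4)) (by rw [S2.phiK_fourteen_five]; norm_num) ⟨m, hm, hpoly, tail_twelve_six_k2 S m htail⟩
  have cellA : ∀ (U S m : ℕ) (A : ℚ), Matroid.topCount M 12 5 ≤ U → {X : Set α | X ⊆ M.E ∧ M.eRk X = M.eRank}.ncard ≤ S → m ≤ 1024 →
      1024 * (U : ℚ) ≤ ((1024 - m : ℕ) : ℚ) * 2 ^ (6 - 5) * (14474 : ℚ) →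
      (1024 : ℚ) * (A + (S : ℚ)) ≤ (m : ℚ) * 2 ^ 18 →
      ({X : Set α | X ⊆ M.E ∧ M.eRk X ≤ 5}.ncard : ℚ) ≤ A → ((phiK 14 5 - 6) / 4) * (Matroid.topCount M 12 5 : ℚ) ≤ (Matroid.midCount M 12 5 : ℚ) := by
    intro U S m A hU hS hm hpoly htail hA
    exact c025_core_five_cell_of_counts_xqictq5g M 12 6 (by norm_num) hR hn U hU _ hA S hS
      14474 (by norm_num) (((phiK 14 5 - 6) / 4)) (by rw [S2.phiK_fourteen_five]; norm_num) ⟨m, hm, hpoly, htail⟩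
  by_cases h5 : ∃ W ⊆ M.E, W.ncard ≤ 10 ∧ W.encard = M.eRk W + 5
  · obtain ⟨W, hW, hWn, hWk⟩ := h5
    have hU' : Matroid.topCount M 12 5 ≤ 4158 := by
      refine (full 5 hW hWk).trans ?_
      generalize W.ncard = w at hWn ⊢
      interval_cases w <;> decide
    have hS' : {X : Set α | X ⊆ M.E ∧ M.eRk X = M.eRank}.ncard ≤ 5952 := by
      refine (span 5 hW hWk).trans ?_
      generalize W.ncard = w at hWn ⊢
      interval_cases w <;> decide
    exact cell 4158 5952 255 hU' hS' (by norm_num) (by norm_num) (by norm_num)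
  by_cases h4 : ∃ W ⊆ M.E, W.ncard ≤ 9 ∧ W.encard = M.eRk W + 4
  · obtain ⟨W, hW, hWn, hWk⟩ := h4
    have hU' : Matroid.topCount M 12 5 ≤ 10038 := by
      refine (full 4 hW hWk).trans ?_
      generalize W.ncard = w at hWn ⊢
      interval_cases w <;> decide
    have hS' : {X : Set α | X ⊆ M.E ∧ M.eRk X = M.eRank}.ncard ≤ 13120 := by
      refine (span 4 hW hWk).trans ?_
      generalize W.ncard = w at hWn ⊢
      interval_cases w <;> decide
    exact cell 10038 13120 283 hU' hS' (by norm_num) (by norm_num) (by norm_num)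
  · -- spread: rank-`5` sets `≤ 8`, rank-`4` sets `≤ 7`; the triangle trade-off
    have hflat : ∀ X ⊆ M.E, M.eRk X ≤ 5 → X.ncard ≤ 8 := fun X hX hr => by
      have := S2.ncard_le_of_eRk_le_of_not_nullity M 4 9 (by norm_num) h4 hX (r := 5) (by norm_num) (by exact_mod_cast hr)
      omega
    have hflat' : ∀ X ⊆ M.E, M.eRk X ≤ 4 → X.ncard ≤ 7 := fun X hX hr => by
      have := S2.ncard_le_of_eRk_le_of_not_nullity M 4 9 (by norm_num) h4 hX (r := 4) (by norm_num) (by exact_mod_cast hr)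
      omega
    have hA := ncard_eRk_le_five_le_spread M 12 6 (by norm_num) hR hn hfree hflat hflat' 10 46 234 hs3 hs4 hs5
    have hEcard : M.ground_finite.toFinset.card = 12 + 6 := by
      rw [← Set.ncard_eq_toFinset_card _ M.ground_finite]; exact hn
    have hU := topCount_le_flat_sharp M 12 6 (by norm_num) (by norm_num) hR hn hfree 8 7 hflat hflat' (by norm_num) (by norm_num)
      10 46 234 hs3 hs4 hs5
    norm_num [Finset.sum_range_succ, Nat.choose] at hU
    have hU' : Matroid.topCount M 12 5 ≤ 19803 := hU.trans (by norm_num)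
    have hS := Matroid.ncard_spanning_le (M := M) hd
    rw [hEcard] at hS
    have hS' : {X : Set α | X ⊆ M.E ∧ M.eRk X = M.eRank}.ncard ≤ 31180 := hS.trans (by decide)
    exact cellA 19803 31180 276 _ hU' hS' (by norm_num) (by norm_num) (by norm_num [Nat.choose]) hA

end ThmN

end PercRepro
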